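import Mathlib
import Summits.Ventures.PercRepro2.Defs
import Summits.Ventures.PercRepro2.Independence
import Summits.Ventures.PercRepro2.Graph
import Summits.Ventures.PercRepro2.Induced
import Summits.Ventures.PercRepro2.HullDefs

/-!
# The piece flip preserves the hull (blind cell PercRepro2, typer-1; lead g10
`LEAD-PROOFSHAPES.md` ADDENDUM 24 (4)(a), ask 2026-08-23T06:35:39Z)

For a red piece `P` (`IsRedPiece`: `P ⊆ R_side`, closed under adjacency inside `hull ∖ core`) that
is NON-CRITICAL (`NonCritRed`: `Red − P` keeps every core vertex joined to `l`), flipping every edge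
touching `P` (`flip`) gives a colouring `ζ′` with

* `C_R^{ζ′}(l) = C_R(l) ∖ P` (`cluster_flip_eq`), `C_B^{ζ′}(l) = C_B(l) ∪ P` (`cluster_blue_flip_eq`);
* the same hull and core (`hull_flip`, `core_flip`), `R_side′ = R_side ∖ P`, `B_side′ = B_side ∪ P`,
  the same pieces (`piece_flip`), and `P` is a non-critical BLUE piece of `ζ′` (`nonCritRed_blue_flip`);
* the edge colours at the core and at the hull boundary (ADDENDUM 24 (1)(ii));
* MONOTONICITY (ADDENDUM 24 (1)(iv)): for `h ∉ H_l`, a blue connection `h ↔_B b` in `ζ′` was already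
  present in `ζ` (`conn_blue_of_conn_blue_flip`) — the flip can only destroy blue connections from
  outside the hull.
-/

namespace Summit.Ventures.PercRepro2

namespace Hull

variable {V : Type*} {E : Type*} {ends : E → Sym2 V} {ζ : Config E} {l o : V} {P : Set V}

/-! ## Edges at the core and at the boundary (ADDENDUM 24 (1)(ii)) -/

/-- A core–red-side edge is red. -/
lemma edge_core_rside_red {x y : V} {e : E} (hx : x ∈ core ends ζ l) (hy : y ∈ rside ends ζ l)
    (hends : ends e = s(x, y)) : ζ e = true := by
  cases he : ζ e with
  | true => rfl
  | false => exact absurd (mem_cluster_of_edge hx.2 (blue_eq_true_iff.2 he) hends) hy.2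

/-- A core–blue-side edge is blue. -/
lemma edge_core_bside_blue {x y : V} {e : E} (hx : x ∈ core ends ζ l) (hy : y ∈ bside ends ζ l)
    (hends : ends e = s(x, y)) : ζ e = false := by
  cases he : ζ e with
  | true => exact absurd (mem_cluster_of_edge hx.1 he hends) hy.2
  | false => rfl

/-- The core has no edge to the outside of the hull. -/
lemma no_edge_core_outside {x y : V} {e : E} (hx : x ∈ core ends ζ l) (hy : y ∉ hull ends ζ l)
    (hends : ends e = s(x, y)) : False := by
  cases he : ζ e with
  | true => exact hy (Or.inl (mem_cluster_of_edge hx.1 he hends))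
  | false => exact hy (Or.inr (mem_cluster_of_edge hx.2 (blue_eq_true_iff.2 he) hends))

/-- A boundary edge of the red side (to the outside of the hull) is blue. -/
lemma edge_rside_outside_blue {x y : V} {e : E} (hx : x ∈ rside ends ζ l) (hy : y ∉ hull ends ζ l)
    (hends : ends e = s(x, y)) : ζ e = false := by
  cases he : ζ e with
  | true => exact absurd (Or.inl (mem_cluster_of_edge hx.1 he hends)) hy
  | false => rfl

/-- A boundary edge of the blue side (to the outside of the hull) is red. -/
lemma edge_bside_outside_red {x y : V} {e : E} (hx : x ∈ bside ends ζ l) (hy : y ∉ hull ends ζ l)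
    (hends : ends e = s(x, y)) : ζ e = true := by
  cases he : ζ e with
  | true => rfl
  | false => exact absurd (Or.inr (mem_cluster_of_edge hx.1 (blue_eq_true_iff.2 he) hends)) hy

/-! ## Red pieces -/

/-- `P` is a red piece: a subset of the red side closed under adjacency inside `hull ∖ core`. -/
structure IsRedPiece (ends : E → Sym2 V) (ζ : Config E) (l : V) (P : Set V) : Prop where
  /-- `P ⊆ R_side`. -/
  subset : P ⊆ rside ends ζ l
  /-- closed under adjacency inside `hull ∖ core`. -/
  closed : ∀ x ∈ P, ∀ y ∈ hull ends ζ l \ core ends ζ l, ∀ e, ends e = s(x, y) → y ∈ P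

/-- A red piece lies in the red cluster of `l`. -/
lemma IsRedPiece.subset_CR (hP : IsRedPiece ends ζ l P) : P ⊆ cluster ends ζ l :=
  fun _ hx => (hP.subset hx).1

/-- A red piece avoids the blue cluster of `l`. -/
lemma IsRedPiece.notMem_CB (hP : IsRedPiece ends ζ l P) {x : V} (hx : x ∈ P) :
    x ∉ cluster ends (blue ζ) l :=
  (hP.subset hx).2

/-- `l` is not in a red piece. -/
lemma IsRedPiece.l_notMem (hP : IsRedPiece ends ζ l P) : l ∉ P :=
  fun h => (hP.subset h).2 (mem_cluster_self _ _ _)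

/-- A red-side vertex adjacent to `P` lies in `P`. -/
lemma IsRedPiece.mem_of_edge (hP : IsRedPiece ends ζ l P) {x y : V} {e : E} (hy : y ∈ P)
    (hxR : x ∈ cluster ends ζ l) (hxB : x ∉ cluster ends (blue ζ) l) (hends : ends e = s(y, x)) :
    x ∈ P :=
  hP.closed y hy x (rside_subset_hull_sdiff_core ζ l ⟨hxR, hxB⟩) e hends

/-- The piece of a red-side vertex is a red piece. -/
lemma isRedPiece_piece (ho : o ∈ rside ends ζ l) : IsRedPiece ends ζ l (piece ends ζ l o) :=
  ⟨piece_subset_rside ho, fun _ hx _ hy _ he =>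
    mem_piece_of_edge hx (piece_subset (rside_subset_hull_sdiff_core ζ l ho) hx) hy he⟩

/-! ## The red cluster after the flip -/

/-- **`C_R^{ζ′}(l) = C_R(l) ∖ P`** for a non-critical red piece `P`. -/
theorem cluster_flip_eq (hP : IsRedPiece ends ζ l P) (hnc : NonCritRed ends ζ l P) :
    cluster ends (flip ends P ζ) l = cluster ends ζ l \ P := by
  have h1 : cluster ends (flip ends P ζ) l ⊆ cluster ends ζ l \ P := by
    intro u hu
    refine mem_of_conn_of_closed (ends := ends) (ω := flip ends P ζ)
      (S := cluster ends ζ l \ P) ?_ ⟨mem_cluster_self _ _ _, hP.l_notMem⟩ hu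
    intro x hx y hxy
    obtain ⟨_, e, he, hends⟩ := exists_edge_of_adj hxy
    by_cases hyP : y ∈ P
    · exfalso
      have ht : e ∈ touches ends P := (mem_touches_iff_of_ends hends).2 (Or.inr hyP)
      rw [flip_apply_of_mem ht] at he
      have he' : ζ e = false := by simpa using he
      by_cases hxB : x ∈ cluster ends (blue ζ) l
      · exact hP.notMem_CB hyP (mem_cluster_of_edge hxB (blue_eq_true_iff.2 he') hends)
      · exact hx.2 (hP.mem_of_edge hyP hx.1 hxB (ends_swap hends))
    · have ht : e ∉ touches ends P := fun h => by
        rcases (mem_touches_iff_of_ends hends).1 h with h | h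
        · exact hx.2 h
        · exact hyP h
      rw [flip_apply_of_notMem ht] at he
      exact ⟨mem_cluster_of_edge hx.1 he hends, hyP⟩
  have h2 : cluster ends ζ l ⊆ cluster ends (flip ends P ζ) l ∪ P := by
    intro u hu
    refine mem_of_conn_of_closed (ends := ends) (ω := ζ)
      (S := cluster ends (flip ends P ζ) l ∪ P) ?_ (Or.inl (mem_cluster_self _ _ _)) hu
    intro x hx y hxy
    obtain ⟨_, e, he, hends⟩ := exists_edge_of_adj hxy
    by_cases hyP : y ∈ P
    · exact Or.inr hyP
    · rcases hx with hx | hxP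
      · have hxP : x ∉ P := (h1 hx).2
        have ht : e ∉ touches ends P := fun h => by
          rcases (mem_touches_iff_of_ends hends).1 h with h | h
          · exact hxP h
          · exact hyP h
        have he' : flip ends P ζ e = true := by rw [flip_apply_of_notMem ht]; exact he
        exact Or.inl (mem_cluster_of_edge hx he' hends)
      · have hyR : y ∈ cluster ends ζ l := mem_cluster_of_edge (hP.subset_CR hxP) he hends
        by_cases hyB : y ∈ cluster ends (blue ζ) l
        · exact Or.inl (conn_mono (delConfig_le_flip P ζ) (hnc y ⟨hyR, hyB⟩))
        · exact absurd (hP.mem_of_edge hxP hyR hyB hends) hyP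
  refine Set.Subset.antisymm h1 fun u hu => ?_
  rcases h2 hu.1 with h | h
  · exact h
  · exact absurd h hu.2

/-! ## The blue cluster after the flip -/

/-- Blue paths from `l` never touch a red piece: the blue cluster of `l` survives in any colouring
agreeing with `blue ζ` off the edges touching `P`. -/
theorem cluster_blue_subset_of_agree (hP : IsRedPiece ends ζ l P) {ω' : Config E}
    (hω' : ∀ e ∉ touches ends P, ω' e = blue ζ e) :
    cluster ends (blue ζ) l ⊆ cluster ends ω' l := by
  intro u hu
  have key : u ∈ cluster ends ω' l ∩ cluster ends (blue ζ) l := by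
    refine mem_of_conn_of_closed (ends := ends) (ω := blue ζ)
      (S := cluster ends ω' l ∩ cluster ends (blue ζ) l) ?_
      ⟨mem_cluster_self _ _ _, mem_cluster_self _ _ _⟩ hu
    intro x hx y hxy
    obtain ⟨_, e, he, hends⟩ := exists_edge_of_adj hxy
    have hyB : y ∈ cluster ends (blue ζ) l := mem_cluster_of_edge hx.2 he hends
    have ht : e ∉ touches ends P := fun h => by
      rcases (mem_touches_iff_of_ends hends).1 h with h | h
      · exact hP.notMem_CB h hx.2
      · exact hP.notMem_CB h hyB
    have he' : ω' e = true := by rw [hω' e ht]; exact he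
    exact ⟨mem_cluster_of_edge hx.1 he' hends, hyB⟩
  exact key.1

/-- The blue cluster of `l` grows under the flip. -/
lemma cluster_blue_subset_cluster_blue_flip (hP : IsRedPiece ends ζ l P) :
    cluster ends (blue ζ) l ⊆ cluster ends (blue (flip ends P ζ)) l :=
  cluster_blue_subset_of_agree hP fun e he => by rw [blue_flip, flip_apply_of_notMem he]

/-- After the flip, `P` is blue-connected to `l`. -/
theorem subset_cluster_blue_flip (hP : IsRedPiece ends ζ l P) :
    P ⊆ cluster ends (blue (flip ends P ζ)) l := by
  have hBB := cluster_blue_subset_cluster_blue_flip hP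
  have key : cluster ends ζ l ⊆
      (cluster ends ζ l \ P) ∪ (P ∩ cluster ends (blue (flip ends P ζ)) l) := by
    intro u hu
    refine mem_of_conn_of_closed (ends := ends) (ω := ζ) ?_
      (Or.inl ⟨mem_cluster_self _ _ _, hP.l_notMem⟩) hu
    intro x hx y hxy
    obtain ⟨_, e, he, hends⟩ := exists_edge_of_adj hxy
    by_cases hyP : y ∈ P
    · have ht : e ∈ touches ends P := (mem_touches_iff_of_ends hends).2 (Or.inr hyP)
      have he' : blue (flip ends P ζ) e = true := by
        rw [blue_flip, flip_apply_of_mem ht, blue_apply, Bool.not_not]; exact he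
      rcases hx with ⟨hxR, hxP⟩ | ⟨hxP, hxB'⟩
      · by_cases hxB : x ∈ cluster ends (blue ζ) l
        · exact Or.inr ⟨hyP, mem_cluster_of_edge (hBB hxB) he' hends⟩
        · exact absurd (hP.mem_of_edge hyP hxR hxB (ends_swap hends)) hxP
      · exact Or.inr ⟨hyP, mem_cluster_of_edge hxB' he' hends⟩
    · have hxR : x ∈ cluster ends ζ l := by
        rcases hx with h | h
        · exact h.1
        · exact hP.subset_CR h.1
      exact Or.inl ⟨mem_cluster_of_edge hxR he hends, hyP⟩
  intro y hy
  rcases key (hP.subset_CR hy) with h | h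
  · exact absurd hy h.2
  · exact h.2

/-- The blue cluster of `l` after the flip is contained in `C_B(l) ∪ P`. -/
theorem cluster_blue_flip_subset (hP : IsRedPiece ends ζ l P) :
    cluster ends (blue (flip ends P ζ)) l ⊆ cluster ends (blue ζ) l ∪ P := by
  intro u hu
  refine mem_of_conn_of_closed (ends := ends) (ω := blue (flip ends P ζ)) ?_
    (Or.inl (mem_cluster_self _ _ _)) hu
  intro x hx y hxy
  obtain ⟨_, e, he, hends⟩ := exists_edge_of_adj hxy
  by_cases ht : e ∈ touches ends P
  · have he' : ζ e = true := by
      rw [blue_flip, flip_apply_of_mem ht, blue_apply, Bool.not_not] at he; exact he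
    by_cases hyP : y ∈ P
    · exact Or.inr hyP
    · have hxP : x ∈ P := by
        rcases (mem_touches_iff_of_ends hends).1 ht with h | h
        · exact h
        · exact absurd h hyP
      have hyR : y ∈ cluster ends ζ l := mem_cluster_of_edge (hP.subset_CR hxP) he' hends
      by_cases hyB : y ∈ cluster ends (blue ζ) l
      · exact Or.inl hyB
      · exact Or.inr (hP.mem_of_edge hxP hyR hyB hends)
  · have he' : blue ζ e = true := by rw [blue_flip, flip_apply_of_notMem ht] at he; exact he
    rcases hx with hxB | hxP
    · exact Or.inl (mem_cluster_of_edge hxB he' hends)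
    · exact absurd hxP (not_mem_of_not_mem_touches hends ht).1

/-- **`C_B^{ζ′}(l) = C_B(l) ∪ P`** for a red piece `P`. -/
theorem cluster_blue_flip_eq (hP : IsRedPiece ends ζ l P) :
    cluster ends (blue (flip ends P ζ)) l = cluster ends (blue ζ) l ∪ P :=
  Set.Subset.antisymm (cluster_blue_flip_subset hP)
    (Set.union_subset (cluster_blue_subset_cluster_blue_flip hP) (subset_cluster_blue_flip hP))

/-! ## Hull, core, sides and pieces after the flip -/

/-- The flip of a non-critical red piece preserves the hull. -/
theorem hull_flip (hP : IsRedPiece ends ζ l P) (hnc : NonCritRed ends ζ l P) :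
    hull ends (flip ends P ζ) l = hull ends ζ l := by
  unfold hull
  rw [cluster_flip_eq hP hnc, cluster_blue_flip_eq hP]
  ext x
  simp only [Set.mem_union, Set.mem_sdiff]
  constructor
  · rintro (⟨h, _⟩ | h | h)
    · exact Or.inl h
    · exact Or.inr h
    · exact Or.inl (hP.subset_CR h)
  · rintro (h | h)
    · by_cases hx : x ∈ P
      · exact Or.inr (Or.inr hx)
      · exact Or.inl ⟨h, hx⟩
    · exact Or.inr (Or.inl h)

/-- The flip of a non-critical red piece preserves the core. -/
theorem core_flip (hP : IsRedPiece ends ζ l P) (hnc : NonCritRed ends ζ l P) :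
    core ends (flip ends P ζ) l = core ends ζ l := by
  unfold core
  rw [cluster_flip_eq hP hnc, cluster_blue_flip_eq hP]
  ext x
  simp only [Set.mem_inter_iff, Set.mem_union, Set.mem_sdiff]
  constructor
  · rintro ⟨⟨hR, hP'⟩, hB | hB⟩
    · exact ⟨hR, hB⟩
    · exact absurd hB hP'
  · rintro ⟨hR, hB⟩
    exact ⟨⟨hR, fun h => hP.notMem_CB h hB⟩, Or.inl hB⟩

/-- The red side after the flip is `R_side ∖ P`. -/
theorem rside_flip (hP : IsRedPiece ends ζ l P) (hnc : NonCritRed ends ζ l P) :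
    rside ends (flip ends P ζ) l = rside ends ζ l \ P := by
  unfold rside
  rw [cluster_flip_eq hP hnc, cluster_blue_flip_eq hP]
  ext x
  simp only [Set.mem_sdiff, Set.mem_union, not_or]
  constructor
  · rintro ⟨⟨hR, hP'⟩, hB, _⟩
    exact ⟨⟨hR, hB⟩, hP'⟩
  · rintro ⟨⟨hR, hB⟩, hP'⟩
    exact ⟨⟨hR, hP'⟩, hB, hP'⟩

/-- The blue side after the flip is `B_side ∪ P`. -/
theorem bside_flip (hP : IsRedPiece ends ζ l P) (hnc : NonCritRed ends ζ l P) :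
    bside ends (flip ends P ζ) l = bside ends ζ l ∪ P := by
  unfold bside
  rw [cluster_flip_eq hP hnc, cluster_blue_flip_eq hP]
  ext x
  simp only [Set.mem_sdiff, Set.mem_union]
  constructor
  · rintro ⟨hB | hB, h⟩
    · by_cases hx : x ∈ P
      · exact Or.inr hx
      · exact Or.inl ⟨hB, fun hR => h ⟨hR, hx⟩⟩
    · exact Or.inr hB
  · rintro (⟨hB, hR⟩ | hx)
    · exact ⟨Or.inl hB, fun h => hR h.1⟩
    · exact ⟨Or.inr hx, fun h => h.2 hx⟩

/-- The free configuration is preserved. -/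
theorem freeConfig_flip (hP : IsRedPiece ends ζ l P) (hnc : NonCritRed ends ζ l P) :
    freeConfig ends (flip ends P ζ) l = freeConfig ends ζ l := by
  unfold freeConfig
  rw [hull_flip hP hnc, core_flip hP hnc]

/-- The pieces are preserved. -/
theorem piece_flip (hP : IsRedPiece ends ζ l P) (hnc : NonCritRed ends ζ l P) (o : V) :
    piece ends (flip ends P ζ) l o = piece ends ζ l o := by
  unfold piece
  rw [freeConfig_flip hP hnc]

/-- After the flip, `P` is a non-critical blue piece. -/
theorem nonCritRed_blue_flip (hP : IsRedPiece ends ζ l P) (hnc : NonCritRed ends ζ l P) :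
    NonCritRed ends (blue (flip ends P ζ)) l P := by
  intro k hk
  rw [core_blue, core_flip hP hnc] at hk
  rw [delConfig_blue_flip]
  exact cluster_blue_subset_of_agree hP (fun e he => delConfig_apply_of_notMem he) hk.2

/-- After the flip, `P` is a red piece of the blue colouring. -/
theorem isRedPiece_blue_flip (hP : IsRedPiece ends ζ l P) (hnc : NonCritRed ends ζ l P) :
    IsRedPiece ends (blue (flip ends P ζ)) l P := by
  refine ⟨?_, ?_⟩
  · rw [rside_blue, bside_flip hP hnc]
    exact Set.subset_union_right
  · intro x hx y hy e he
    rw [hull_blue, core_blue, hull_flip hP hnc, core_flip hP hnc] at hy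
    exact hP.closed x hx y hy e he

/-! ## Monotonicity of blue connections from outside the hull -/

/-- **ADDENDUM 24 (1)(iv)**: for `h ∉ H_l`, a blue connection `h ↔_B b` after the flip of a red
piece was already present before it. -/
theorem conn_blue_of_conn_blue_flip (hP : IsRedPiece ends ζ l P) {h b : V}
    (hh : h ∉ hull ends ζ l) (hc : Conn ends (blue (flip ends P ζ)) h b) :
    Conn ends (blue ζ) h b := by
  have key : b ∈ {u | Conn ends (blue ζ) h u ∧ u ∉ P ∧ u ∉ cluster ends (blue ζ) l} := by
    refine mem_of_conn_of_closed (ends := ends) (ω := blue (flip ends P ζ)) ?_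
      ⟨conn_refl _ _ _, fun hP' => hh (Or.inl (hP.subset_CR hP')), fun hB => hh (Or.inr hB)⟩ hc
    intro x hx y hxy
    obtain ⟨_, e, he, hends⟩ := exists_edge_of_adj hxy
    obtain ⟨hxc, hxP, hxB⟩ := hx
    by_cases hyP : y ∈ P
    · exfalso
      have ht : e ∈ touches ends P := (mem_touches_iff_of_ends hends).2 (Or.inr hyP)
      have he' : ζ e = true := by
        rw [blue_flip, flip_apply_of_mem ht, blue_apply, Bool.not_not] at he; exact he
      have hxR : x ∈ cluster ends ζ l :=
        mem_cluster_of_edge (hP.subset_CR hyP) he' (ends_swap hends)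
      exact hxP (hP.mem_of_edge hyP hxR hxB (ends_swap hends))
    · have ht : e ∉ touches ends P := fun h => by
        rcases (mem_touches_iff_of_ends hends).1 h with h | h
        · exact hxP h
        · exact hyP h
      have he' : blue ζ e = true := by rw [blue_flip, flip_apply_of_notMem ht] at he; exact he
      exact ⟨mem_cluster_of_edge hxc he' hends, hyP,
        fun hyB => hxB (mem_cluster_of_edge hyB he' (ends_swap hends))⟩
  exact key.1

end Hull

end Summit.Ventures.PercRepro2
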